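import Mathlib
import Summits.Ventures.PercRepro2.K5Theorem
import Summits.Ventures.PercRepro2.HubBernstein
import Summits.Ventures.PercRepro2.RootPairSepTyped
import Summits.Ventures.PercRepro2.PMK5Kernel
import Summits.Ventures.PercRepro2.PMK5Bridge

/-!
# THE WEIGHTED (PM) PER-SIDE BRACKETS, `(C4)` AND THE TYPED BRACKET `β₁` ARE THEOREMS ON `K₅` FOR EVERY
WEIGHT VECTOR (blind cell PercRepro2, mine-2 g22; row 2′BETA1; the last bridge file of the `K₅` (PM) certificate)

`K₅` on the five marks `(o, a₁, a₂, u, b) = (0, 1, 2, 3, 4)` (`K5.ends5`).  The cleared L-half of the weighted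
(PM), `P(Q)³·(HALF-PM⁺)_L` (the expression of `CutMixedPM.halfL_mixed_nonneg` /
`RootPairSepPM.halfL_nonneg_of_u_alone`), is a cubic in nine masses; each mass is the Bernstein-1 form
`Hub.bform p (indR T)` of its event table (`K5.prob_eq_bform`; the tables of `PMK5Kernel.lean` are the tree's
events by `PMK5Bridge.lean`), so by the Bernstein regrouping `Hub.bform_mul_mul` the cubic is
`Σ_k bern p k · (cntPosL k − cntNegL k)` with `cntPosL − cntNegL` the signed 3-copy class sums (`K5.cnt3`).
`PMK5Bridge.cntNegL_le_cntPosL` (from the kernel certificate `PM.certL` through the digit argument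
`K5.le_of_kron_le`) makes every coefficient `≥ 0`, and `bern p k ≥ 0` on `[0,1]^10`:

* **`halfL_K5`**, **`halfH_K5`**: both per-side brackets of the weighted (PM) are `≥ 0` on `K₅` for every
  admissible `p : Fin 10 → R`;
* **`c4_K5`**: the sharpening `(C4)` — `Cov_Q(L_b, H_u (L_o − p_o)) ≥ 0`, `p_o = P_Q(o ∈ C₁ ∪ C₂)` — likewise;
* **`beta1_K5`**: the typed bracket `β₁ = (HALF-PM⁺)_L + (HALF-PM⁺)_H + A` of `RootPairSepTyped.lean` is `≥ 0`
  (`A ≥ 0` on every graph, `RootPairSep.a3piece_nonneg`).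

Every simple graph on five vertices with the five marks on distinct vertices is `K₅` with `p_e = 0` on the
missing edges, so this is the weighted (PM) — both halves, `(C4)`, `β₁` — on every 5-vertex base graph, all
weights: the first block family (`K_{2,3}` with `o, b` at the branch vertices, the 5-vertex thetas, `W₄`,
`K₅ − e`, `K₅`) where Theorem 8 / Theorem 11's certificates are kernel-checked (mine-2 M2-44 (27)(d)); with
the reduction files (root-pair separations, pendant marks, two-terminal pieces) it covers every graph whose
marked root block reduces to five vertices.
-/

namespace Summit.Ventures.PercRepro2

open Hub

namespace K5

namespace PM

/-! ## The brackets in the Bernstein basis, and the theorems -/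

section Bernstein

variable {R : Type*} [Field R] [LinearOrder R] [IsStrictOrderedRing R]

omit [LinearOrder R] [IsStrictOrderedRing R] in
/-- **The cleared `(HALF-PM⁺)_L` on `K₅` in the degree-3 Bernstein basis**:
`Σ_k bern p k · (cntPosL k − cntNegL k)`. -/
theorem halfL_eq_bern (p : Fin 10 → R) :
    prob p (connEvent ends5 1 2)ᶜ *
          (prob p (connEvent ends5 1 2)ᶜ *
              prob p (connEvent ends5 1 4 ∩ connEvent ends5 2 3 ∩
                (connEvent ends5 1 0 ∪ connEvent ends5 2 0) ∩ (connEvent ends5 1 2)ᶜ) -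
            prob p (connEvent ends5 1 4 ∩ (connEvent ends5 1 2)ᶜ) *
              prob p (connEvent ends5 2 3 ∩ (connEvent ends5 1 0 ∪ connEvent ends5 2 0) ∩
                (connEvent ends5 1 2)ᶜ)) -
        prob p ((connEvent ends5 1 0 ∪ connEvent ends5 2 0) ∩ (connEvent ends5 1 2)ᶜ) *
          (prob p (connEvent ends5 1 2)ᶜ *
              prob p (connEvent ends5 1 4 ∩ connEvent ends5 2 3 ∩ (connEvent ends5 1 2)ᶜ) -
            prob p (connEvent ends5 1 4 ∩ (connEvent ends5 1 2)ᶜ) *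
              prob p (connEvent ends5 2 3 ∩ (connEvent ends5 1 2)ᶜ)) -
        prob p (connEvent ends5 1 2)ᶜ *
          (prob p (connEvent ends5 1 2)ᶜ *
              prob p (connEvent ends5 1 4 ∩ connEvent ends5 2 0 ∩ (connEvent ends5 1 2)ᶜ) -
            prob p (connEvent ends5 1 4 ∩ (connEvent ends5 1 2)ᶜ) *
              prob p (connEvent ends5 2 0 ∩ (connEvent ends5 1 2)ᶜ)) =
      ∑ k, bern p k * ((cntPosL k : ℕ) - (cntNegL k : ℕ) : R) := by
  rw [prob_eq_bform p _ _ tQ_iff_compl, prob_eq_bform p _ _ tQBLHuoU_iff, prob_eq_bform p _ _ tQBL_iff',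
    prob_eq_bform p _ _ tQHuoU_iff, prob_eq_bform p _ _ tQoU_iff, prob_eq_bform p _ _ tQBLHu_iff,
    prob_eq_bform p _ _ tQHu_iff, prob_eq_bform p _ _ tQBLHo_iff, prob_eq_bform p _ _ tQHo_iff]
  have e : ∀ a b c d e f g h i : R,
      a * (a * b - c * d) - e * (a * f - c * g) - a * (a * h - c * i) =
        b * a * a + c * g * e + c * i * a - c * d * a - e * a * f - a * a * h := by intros; ring
  rw [e, bform_mul_mul, bform_mul_mul, bform_mul_mul, bform_mul_mul, bform_mul_mul, bform_mul_mul,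
    ← Finset.sum_add_distrib, ← Finset.sum_add_distrib, ← Finset.sum_sub_distrib, ← Finset.sum_sub_distrib,
    ← Finset.sum_sub_distrib]
  refine Finset.sum_congr rfl fun k _ => ?_
  rw [coef3_eq_cnt3, coef3_eq_cnt3, coef3_eq_cnt3, coef3_eq_cnt3, coef3_eq_cnt3, coef3_eq_cnt3]
  unfold cntPosL cntNegL
  push_cast
  ring

omit [LinearOrder R] [IsStrictOrderedRing R] in
/-- **The cleared `(HALF-PM⁺)_H` on `K₅` in the degree-3 Bernstein basis**. -/
theorem halfH_eq_bern (p : Fin 10 → R) :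
    prob p (connEvent ends5 1 2)ᶜ *
          (prob p (connEvent ends5 1 2)ᶜ *
              prob p (connEvent ends5 2 4 ∩ connEvent ends5 1 3 ∩
                (connEvent ends5 1 0 ∪ connEvent ends5 2 0) ∩ (connEvent ends5 1 2)ᶜ) -
            prob p (connEvent ends5 2 4 ∩ (connEvent ends5 1 2)ᶜ) *
              prob p (connEvent ends5 1 3 ∩ (connEvent ends5 1 0 ∪ connEvent ends5 2 0) ∩
                (connEvent ends5 1 2)ᶜ)) -
        prob p ((connEvent ends5 1 0 ∪ connEvent ends5 2 0) ∩ (connEvent ends5 1 2)ᶜ) *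
          (prob p (connEvent ends5 1 2)ᶜ *
              prob p (connEvent ends5 2 4 ∩ connEvent ends5 1 3 ∩ (connEvent ends5 1 2)ᶜ) -
            prob p (connEvent ends5 2 4 ∩ (connEvent ends5 1 2)ᶜ) *
              prob p (connEvent ends5 1 3 ∩ (connEvent ends5 1 2)ᶜ)) -
        prob p (connEvent ends5 1 2)ᶜ *
          (prob p (connEvent ends5 1 2)ᶜ *
              prob p (connEvent ends5 2 4 ∩ connEvent ends5 1 0 ∩ (connEvent ends5 1 2)ᶜ) -
            prob p (connEvent ends5 2 4 ∩ (connEvent ends5 1 2)ᶜ) *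
              prob p (connEvent ends5 1 0 ∩ (connEvent ends5 1 2)ᶜ)) =
      ∑ k, bern p k * ((cntPosH k : ℕ) - (cntNegH k : ℕ) : R) := by
  rw [prob_eq_bform p _ _ tQ_iff_compl, prob_eq_bform p _ _ tQBLuoU_iff, prob_eq_bform p _ _ tQB_iff',
    prob_eq_bform p _ _ tQLuoU_iff, prob_eq_bform p _ _ tQoU_iff, prob_eq_bform p _ _ tQBLu_iff,
    prob_eq_bform p _ _ tQLu_iff, prob_eq_bform p _ _ tQBLo_iff, prob_eq_bform p _ _ tQLo_iff]
  have e : ∀ a b c d e f g h i : R,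
      a * (a * b - c * d) - e * (a * f - c * g) - a * (a * h - c * i) =
        b * a * a + c * g * e + c * i * a - c * d * a - e * a * f - a * a * h := by intros; ring
  rw [e, bform_mul_mul, bform_mul_mul, bform_mul_mul, bform_mul_mul, bform_mul_mul, bform_mul_mul,
    ← Finset.sum_add_distrib, ← Finset.sum_add_distrib, ← Finset.sum_sub_distrib, ← Finset.sum_sub_distrib,
    ← Finset.sum_sub_distrib]
  refine Finset.sum_congr rfl fun k _ => ?_
  rw [coef3_eq_cnt3, coef3_eq_cnt3, coef3_eq_cnt3, coef3_eq_cnt3, coef3_eq_cnt3, coef3_eq_cnt3]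
  unfold cntPosH cntNegH
  push_cast
  ring

omit [LinearOrder R] [IsStrictOrderedRing R] in
/-- **The cleared `(C4)` on `K₅` in the degree-3 Bernstein basis**. -/
theorem c4_eq_bern (p : Fin 10 → R) :
    prob p (connEvent ends5 1 2)ᶜ *
          (prob p (connEvent ends5 1 2)ᶜ *
              prob p (connEvent ends5 1 4 ∩ connEvent ends5 2 3 ∩ connEvent ends5 1 0 ∩
                (connEvent ends5 1 2)ᶜ) -
            prob p (connEvent ends5 1 4 ∩ (connEvent ends5 1 2)ᶜ) *
              prob p (connEvent ends5 2 3 ∩ connEvent ends5 1 0 ∩ (connEvent ends5 1 2)ᶜ)) -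
        prob p ((connEvent ends5 1 0 ∪ connEvent ends5 2 0) ∩ (connEvent ends5 1 2)ᶜ) *
          (prob p (connEvent ends5 1 2)ᶜ *
              prob p (connEvent ends5 1 4 ∩ connEvent ends5 2 3 ∩ (connEvent ends5 1 2)ᶜ) -
            prob p (connEvent ends5 1 4 ∩ (connEvent ends5 1 2)ᶜ) *
              prob p (connEvent ends5 2 3 ∩ (connEvent ends5 1 2)ᶜ)) =
      ∑ k, bern p k * ((cntPosC4 k : ℕ) - (cntNegC4 k : ℕ) : R) := by
  rw [prob_eq_bform p _ _ tQ_iff_compl, prob_eq_bform p _ _ tQBLHuLo_iff, prob_eq_bform p _ _ tQBL_iff',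
    prob_eq_bform p _ _ tQHuLo_iff, prob_eq_bform p _ _ tQoU_iff, prob_eq_bform p _ _ tQBLHu_iff,
    prob_eq_bform p _ _ tQHu_iff]
  have e : ∀ a b c d e f g : R,
      a * (a * b - c * d) - e * (a * f - c * g) = b * a * a + c * g * e - c * d * a - e * a * f := by
    intros; ring
  rw [e, bform_mul_mul, bform_mul_mul, bform_mul_mul, bform_mul_mul,
    ← Finset.sum_add_distrib, ← Finset.sum_sub_distrib, ← Finset.sum_sub_distrib]
  refine Finset.sum_congr rfl fun k _ => ?_
  rw [coef3_eq_cnt3, coef3_eq_cnt3, coef3_eq_cnt3, coef3_eq_cnt3]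
  unfold cntPosC4 cntNegC4
  push_cast
  ring

/-- **THE L-HALF OF THE WEIGHTED (PM) ON `K₅`, EVERY WEIGHT VECTOR**: `P(Q)³ · (HALF-PM⁺)_L ≥ 0` for every
admissible `p ∈ [0,1]^10`, marks `(o, a₁, a₂, u, b) = (0, 1, 2, 3, 4)` — hence on every simple graph on
five vertices carrying the five marks (the missing edges at weight `0`). -/
theorem halfL_K5 (p : Fin 10 → R) (hp : IsProbVec p) :
    0 ≤ prob p (connEvent ends5 1 2)ᶜ *
          (prob p (connEvent ends5 1 2)ᶜ *
              prob p (connEvent ends5 1 4 ∩ connEvent ends5 2 3 ∩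
                (connEvent ends5 1 0 ∪ connEvent ends5 2 0) ∩ (connEvent ends5 1 2)ᶜ) -
            prob p (connEvent ends5 1 4 ∩ (connEvent ends5 1 2)ᶜ) *
              prob p (connEvent ends5 2 3 ∩ (connEvent ends5 1 0 ∪ connEvent ends5 2 0) ∩
                (connEvent ends5 1 2)ᶜ)) -
        prob p ((connEvent ends5 1 0 ∪ connEvent ends5 2 0) ∩ (connEvent ends5 1 2)ᶜ) *
          (prob p (connEvent ends5 1 2)ᶜ *
              prob p (connEvent ends5 1 4 ∩ connEvent ends5 2 3 ∩ (connEvent ends5 1 2)ᶜ) -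
            prob p (connEvent ends5 1 4 ∩ (connEvent ends5 1 2)ᶜ) *
              prob p (connEvent ends5 2 3 ∩ (connEvent ends5 1 2)ᶜ)) -
        prob p (connEvent ends5 1 2)ᶜ *
          (prob p (connEvent ends5 1 2)ᶜ *
              prob p (connEvent ends5 1 4 ∩ connEvent ends5 2 0 ∩ (connEvent ends5 1 2)ᶜ) -
            prob p (connEvent ends5 1 4 ∩ (connEvent ends5 1 2)ᶜ) *
              prob p (connEvent ends5 2 0 ∩ (connEvent ends5 1 2)ᶜ)) := by
  rw [halfL_eq_bern]
  refine Finset.sum_nonneg fun k _ => mul_nonneg (bern_nonneg (fun i => ⟨hp.nonneg i, hp.le_one i⟩) k) ?_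
  rw [sub_nonneg]
  exact_mod_cast cntNegL_le_cntPosL k

/-- **THE H-HALF OF THE WEIGHTED (PM) ON `K₅`, EVERY WEIGHT VECTOR**: `P(Q)³ · (HALF-PM⁺)_H ≥ 0` (the mirror:
`H_b = {b ∈ C₂}`, `L_u = {u ∈ C₁}`). -/
theorem halfH_K5 (p : Fin 10 → R) (hp : IsProbVec p) :
    0 ≤ prob p (connEvent ends5 1 2)ᶜ *
          (prob p (connEvent ends5 1 2)ᶜ *
              prob p (connEvent ends5 2 4 ∩ connEvent ends5 1 3 ∩
                (connEvent ends5 1 0 ∪ connEvent ends5 2 0) ∩ (connEvent ends5 1 2)ᶜ) -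
            prob p (connEvent ends5 2 4 ∩ (connEvent ends5 1 2)ᶜ) *
              prob p (connEvent ends5 1 3 ∩ (connEvent ends5 1 0 ∪ connEvent ends5 2 0) ∩
                (connEvent ends5 1 2)ᶜ)) -
        prob p ((connEvent ends5 1 0 ∪ connEvent ends5 2 0) ∩ (connEvent ends5 1 2)ᶜ) *
          (prob p (connEvent ends5 1 2)ᶜ *
              prob p (connEvent ends5 2 4 ∩ connEvent ends5 1 3 ∩ (connEvent ends5 1 2)ᶜ) -
            prob p (connEvent ends5 2 4 ∩ (connEvent ends5 1 2)ᶜ) *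
              prob p (connEvent ends5 1 3 ∩ (connEvent ends5 1 2)ᶜ)) -
        prob p (connEvent ends5 1 2)ᶜ *
          (prob p (connEvent ends5 1 2)ᶜ *
              prob p (connEvent ends5 2 4 ∩ connEvent ends5 1 0 ∩ (connEvent ends5 1 2)ᶜ) -
            prob p (connEvent ends5 2 4 ∩ (connEvent ends5 1 2)ᶜ) *
              prob p (connEvent ends5 1 0 ∩ (connEvent ends5 1 2)ᶜ)) := by
  rw [halfH_eq_bern]
  refine Finset.sum_nonneg fun k _ => mul_nonneg (bern_nonneg (fun i => ⟨hp.nonneg i, hp.le_one i⟩) k) ?_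
  rw [sub_nonneg]
  exact_mod_cast cntNegH_le_cntPosH k

/-- **THE SHARPENING `(C4)` ON `K₅`, EVERY WEIGHT VECTOR**: `P(Q)³ · Cov_Q(L_b, H_u (L_o − p_o)) ≥ 0`,
`p_o = P_Q(o ∈ C₁ ∪ C₂)`. -/
theorem c4_K5 (p : Fin 10 → R) (hp : IsProbVec p) :
    0 ≤ prob p (connEvent ends5 1 2)ᶜ *
          (prob p (connEvent ends5 1 2)ᶜ *
              prob p (connEvent ends5 1 4 ∩ connEvent ends5 2 3 ∩ connEvent ends5 1 0 ∩
                (connEvent ends5 1 2)ᶜ) -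
            prob p (connEvent ends5 1 4 ∩ (connEvent ends5 1 2)ᶜ) *
              prob p (connEvent ends5 2 3 ∩ connEvent ends5 1 0 ∩ (connEvent ends5 1 2)ᶜ)) -
        prob p ((connEvent ends5 1 0 ∪ connEvent ends5 2 0) ∩ (connEvent ends5 1 2)ᶜ) *
          (prob p (connEvent ends5 1 2)ᶜ *
              prob p (connEvent ends5 1 4 ∩ connEvent ends5 2 3 ∩ (connEvent ends5 1 2)ᶜ) -
            prob p (connEvent ends5 1 4 ∩ (connEvent ends5 1 2)ᶜ) *
              prob p (connEvent ends5 2 3 ∩ (connEvent ends5 1 2)ᶜ)) := by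
  rw [c4_eq_bern]
  refine Finset.sum_nonneg fun k _ => mul_nonneg (bern_nonneg (fun i => ⟨hp.nonneg i, hp.le_one i⟩) k) ?_
  rw [sub_nonneg]
  exact_mod_cast cntNegC4_le_cntPosC4 k

/-- **THE TYPED BRACKET `β₁ = (HALF-PM⁺)_L + (HALF-PM⁺)_H + A` ON `K₅`, EVERY WEIGHT VECTOR** (the expression of
`RootPairSepTyped.beta1_eq_zero_of_b_alone` with `ends := ends5`, `(a₁, a₂, o, u, b) = (1, 2, 0, 3, 4)`): the
weighted (PM) of row 2′BETA1 on every 5-vertex base graph, all weights — the two halves by the kernel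
certificates, `A ≥ 0` by `RootPairSep.a3piece_nonneg`. -/
theorem beta1_K5 (p : Fin 10 → R) (hp : IsProbVec p) :
    0 ≤ prob p (connEvent ends5 1 2)ᶜ *
          (prob p (connEvent ends5 1 2)ᶜ * prob p (connEvent ends5 1 4 ∩ connEvent ends5 2 3 ∩ (connEvent ends5 1 0 ∪ connEvent ends5 2 0) ∩ (connEvent ends5 1 2)ᶜ) -
            prob p (connEvent ends5 1 4 ∩ (connEvent ends5 1 2)ᶜ) * prob p (connEvent ends5 2 3 ∩ (connEvent ends5 1 0 ∪ connEvent ends5 2 0) ∩ (connEvent ends5 1 2)ᶜ)) -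
        prob p ((connEvent ends5 1 0 ∪ connEvent ends5 2 0) ∩ (connEvent ends5 1 2)ᶜ) *
          (prob p (connEvent ends5 1 2)ᶜ * prob p (connEvent ends5 1 4 ∩ connEvent ends5 2 3 ∩ (connEvent ends5 1 2)ᶜ) -
            prob p (connEvent ends5 1 4 ∩ (connEvent ends5 1 2)ᶜ) * prob p (connEvent ends5 2 3 ∩ (connEvent ends5 1 2)ᶜ)) -
        prob p (connEvent ends5 1 2)ᶜ *
          (prob p (connEvent ends5 1 2)ᶜ * prob p (connEvent ends5 1 4 ∩ connEvent ends5 2 0 ∩ (connEvent ends5 1 2)ᶜ) -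
            prob p (connEvent ends5 1 4 ∩ (connEvent ends5 1 2)ᶜ) * prob p (connEvent ends5 2 0 ∩ (connEvent ends5 1 2)ᶜ)) +
        prob p (connEvent ends5 1 2)ᶜ *
          (prob p (connEvent ends5 1 2)ᶜ * prob p (connEvent ends5 2 4 ∩ connEvent ends5 1 3 ∩ (connEvent ends5 1 0 ∪ connEvent ends5 2 0) ∩ (connEvent ends5 1 2)ᶜ) -
            prob p (connEvent ends5 2 4 ∩ (connEvent ends5 1 2)ᶜ) * prob p (connEvent ends5 1 3 ∩ (connEvent ends5 1 0 ∪ connEvent ends5 2 0) ∩ (connEvent ends5 1 2)ᶜ)) -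
        prob p ((connEvent ends5 1 0 ∪ connEvent ends5 2 0) ∩ (connEvent ends5 1 2)ᶜ) *
          (prob p (connEvent ends5 1 2)ᶜ * prob p (connEvent ends5 2 4 ∩ connEvent ends5 1 3 ∩ (connEvent ends5 1 2)ᶜ) -
            prob p (connEvent ends5 2 4 ∩ (connEvent ends5 1 2)ᶜ) * prob p (connEvent ends5 1 3 ∩ (connEvent ends5 1 2)ᶜ)) -
        prob p (connEvent ends5 1 2)ᶜ *
          (prob p (connEvent ends5 1 2)ᶜ * prob p (connEvent ends5 2 4 ∩ connEvent ends5 1 0 ∩ (connEvent ends5 1 2)ᶜ) -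
            prob p (connEvent ends5 2 4 ∩ (connEvent ends5 1 2)ᶜ) * prob p (connEvent ends5 1 0 ∩ (connEvent ends5 1 2)ᶜ)) +
        (prob p ((connEvent ends5 1 3 ∪ connEvent ends5 2 3) ∩ (connEvent ends5 1 2)ᶜ) - prob p (connEvent ends5 1 2)ᶜ) *
          (prob p (connEvent ends5 1 2)ᶜ * prob p (connEvent ends5 1 4 ∩ connEvent ends5 2 0 ∩ (connEvent ends5 1 2)ᶜ) - prob p (connEvent ends5 1 4 ∩ (connEvent ends5 1 2)ᶜ) * prob p (connEvent ends5 2 0 ∩ (connEvent ends5 1 2)ᶜ) +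
            prob p (connEvent ends5 1 2)ᶜ * prob p (connEvent ends5 2 4 ∩ connEvent ends5 1 0 ∩ (connEvent ends5 1 2)ᶜ) - prob p (connEvent ends5 2 4 ∩ (connEvent ends5 1 2)ᶜ) * prob p (connEvent ends5 1 0 ∩ (connEvent ends5 1 2)ᶜ)) := by
  have hL := halfL_K5 p hp
  have hH := halfH_K5 p hp
  have hA := RootPairSep.a3piece_nonneg p hp ends5 1 2 0 3 4
  linarith

end Bernstein

end PM

end K5

end Summit.Ventures.PercRepro2
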